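import Literature.NumberTheory.Transcendental.HypersurfaceGridCount
import Literature.ModelTheory.ExponentialFields.TarskiSeidenbergProofs
import Mathlib.MeasureTheory.Measure.Lebesgue.Basic
import Mathlib.MeasureTheory.Measure.Real
import Mathlib.Data.ENNReal.BigOperators
import HarnessLib

/-!
# Effective Riemann sums for volumes of bounded `ℚ`-semialgebraic sets

Let `D ⊆ [0, R)^{m+1}` be `ℚ`-semialgebraic (`R : ℕ`).  For `n ≥ 1` subdivide `[0, R)^{m+1}` into
the `n^{m+1}` half-open cubes of mesh `R / n` and put (vertex rule)
`S_n = (R/n)^{m+1} · #{k : the grid point (R k_i / n)_i lies in D}`.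
**Theorem** (`exists_abs_volume_sub_riemannSum_le`): there is a constant `c` (depending on `D`) with
`|vol(D) - S_n| ≤ c / n` for all `n ≥ 1`.

This is the convergence-rate statement of Yoshinaga, arXiv:0805.0349, Lemma 29 (there for basic
open `D`, inner cube counts, and via the Minkowski content of `∂D`), in the form used for his
Thm. 18.  Proof: a cube contributes an error at most its volume, and only if it meets both `D` and
its complement; writing `D` by sign conditions on a finite family `Q` of polynomials
(`IsSemialgebraic.exists_eq_setOf_signVec_mem`), such a cube carries two points with different sign
vectors, hence (intermediate value theorem on the segment) a zero of some nonzero `q ∈ Q`, hence of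
`P = ∏_{q ∈ Q, q ≠ 0} q`; by the grid lemma (`exists_card_cubes_zeroSet_le`) at most `c₀ n^m` cubes
meet `Z(P)`, so the error is `≤ c₀ n^m (R/n)^{m+1} = c₀ R^{m+1} / n`.

## References

* M. Yoshinaga, *Periods and elementary real numbers*, arXiv:0805.0349 (2008), §3.4 (Riemann sum),
  Lemma 29 (rate of convergence).
-/

noncomputable section

open MeasureTheory Finset

namespace Literature.NumberTheory.Transcendental

variable {M : ℕ}

/-! ### Half-open grid cubes of the standard grid -/

/-- The half-open cube `∏ᵢ [h kᵢ, h (kᵢ + 1))` of the standard grid of mesh `h` (origin `0`); these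
cubes partition `[0, h n)^M` (Yoshinaga's subdivision of `[0, r]^ℓ`, §3.4, up to faces).
[cite: Yoshinaga2008, §3.4] -/
def gridIcoCube (h : ℝ) (k : Fin M → ℕ) : Set (Fin M → ℝ) :=
  Set.pi Set.univ fun i => Set.Ico (h * k i) (h * (k i + 1))

/-- Membership in a half-open grid cube, coordinatewise. [folklore] -/
theorem mem_gridIcoCube_iff {h : ℝ} {k : Fin M → ℕ} {x : Fin M → ℝ} :
    x ∈ gridIcoCube h k ↔ ∀ i, h * k i ≤ x i ∧ x i < h * (k i + 1) := by
  simp [gridIcoCube, Set.mem_pi, Set.mem_Ico]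

/-- Half-open grid cubes are measurable. [folklore] -/
theorem measurableSet_gridIcoCube (h : ℝ) (k : Fin M → ℕ) : MeasurableSet (gridIcoCube h k) :=
  MeasurableSet.univ_pi fun _ => measurableSet_Ico

/-- The volume of a half-open grid cube of mesh `h ≥ 0` is `h ^ M`. [folklore] -/
theorem volume_real_gridIcoCube {h : ℝ} (hh : 0 ≤ h) (k : Fin M → ℕ) :
    volume.real (gridIcoCube h k) = h ^ M := by
  rw [measureReal_def, gridIcoCube,
    Real.volume_pi_Ico_toReal (a := fun i => h * k i) (b := fun i => h * (k i + 1))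
      (fun i => by dsimp only; nlinarith)]
  simp only [mul_add, mul_one, add_sub_cancel_left, prod_const, card_univ, Fintype.card_fin]

/-- The volume of a half-open grid cube is finite. [folklore] -/
theorem volume_gridIcoCube_lt_top (h : ℝ) (k : Fin M → ℕ) : volume (gridIcoCube h k) < ⊤ := by
  rw [gridIcoCube, Real.volume_pi_Ico]
  exact ENNReal.prod_lt_top fun _ _ => ENNReal.ofReal_lt_top

/-- The half-open cube is contained in the closed cube of the same index. [folklore] -/
theorem gridIcoCube_subset_gridCube (h : ℝ) (k : Fin M → ℕ) :
    gridIcoCube h k ⊆ gridCube 0 h k := fun x hx =>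
  mem_gridCube_iff.2 fun i => by
    have := (mem_gridIcoCube_iff.1 hx) i
    simp only [Pi.zero_apply, zero_add]
    exact ⟨this.1, this.2.le⟩

/-- The corner `(h kᵢ)ᵢ` lies in its half-open cube (`h > 0`). [folklore] -/
theorem corner_mem_gridIcoCube {h : ℝ} (hh : 0 < h) (k : Fin M → ℕ) :
    (fun i => h * k i) ∈ gridIcoCube h k :=
  mem_gridIcoCube_iff.2 fun i => ⟨le_rfl, by nlinarith⟩

/-- Distinct half-open grid cubes are disjoint (`h > 0`). [folklore] -/
theorem disjoint_gridIcoCube {h : ℝ} (hh : 0 < h) {n : ℕ} {k k' : Fin M → Fin n} (hkk' : k ≠ k') :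
    Disjoint (gridIcoCube h fun i => (k i : ℕ)) (gridIcoCube h fun i => (k' i : ℕ)) := by
  rw [Set.disjoint_left]
  intro x hx hx'
  apply hkk'
  funext i
  obtain ⟨h1, h2⟩ := (mem_gridIcoCube_iff.1 hx) i
  obtain ⟨h1', h2'⟩ := (mem_gridIcoCube_iff.1 hx') i
  have a1 : ((k i : ℕ) : ℝ) < (k' i : ℕ) + 1 := by
    by_contra hc; push Not at hc; nlinarith
  have a2 : ((k' i : ℕ) : ℝ) < (k i : ℕ) + 1 := by
    by_contra hc; push Not at hc; nlinarith
  have b1 : (k i : ℕ) < (k' i : ℕ) + 1 := by exact_mod_cast a1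
  have b2 : (k' i : ℕ) < (k i : ℕ) + 1 := by exact_mod_cast a2
  exact Fin.ext (by omega)

/-- The half-open grid cubes cover the box `[0, h n)^M` (`h > 0`). [folklore] -/
theorem exists_mem_gridIcoCube {h : ℝ} (hh : 0 < h) {n : ℕ} {x : Fin M → ℝ}
    (hx : ∀ i, 0 ≤ x i ∧ x i < h * n) : ∃ k : Fin M → Fin n, x ∈ gridIcoCube h fun i => (k i : ℕ) := by
  have hk : ∀ i, ⌊x i / h⌋₊ < n := fun i =>
    (Nat.floor_lt (div_nonneg (hx i).1 hh.le)).2 ((div_lt_iff₀ hh).2 (by linarith [(hx i).2]))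
  refine ⟨fun i => ⟨⌊x i / h⌋₊, hk i⟩, mem_gridIcoCube_iff.2 fun i => ⟨?_, ?_⟩⟩
  · have := Nat.floor_le (div_nonneg (hx i).1 hh.le)
    rw [le_div_iff₀ hh] at this
    simpa [mul_comm] using this
  · have := Nat.lt_floor_add_one (x i / h)
    rw [div_lt_iff₀ hh] at this
    linarith

open Classical in
/-- **Decomposition of the volume along the grid.** For a measurable `D ⊆ [0, h n)^M` (`h > 0`),
`vol(D) = ∑_k vol(D ∩ C_k)` over the half-open grid cubes. [folklore] -/
theorem volume_real_eq_sum_inter_gridIcoCube {h : ℝ} (hh : 0 < h) (n : ℕ) {D : Set (Fin M → ℝ)}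
    (hDm : MeasurableSet D) (hD : ∀ x ∈ D, ∀ i, 0 ≤ x i ∧ x i < h * n) :
    volume.real D =
      ∑ k : Fin M → Fin n, volume.real (D ∩ gridIcoCube h fun i => (k i : ℕ)) := by
  have hcover : D = ⋃ k ∈ (Finset.univ : Finset (Fin M → Fin n)),
      D ∩ gridIcoCube h fun i => (k i : ℕ) := by
    ext x
    simp only [Set.mem_iUnion, Set.mem_inter_iff, Finset.mem_univ, exists_true_left]
    exact ⟨fun hx => ⟨(exists_mem_gridIcoCube hh (hD x hx)).choose, hx,
      (exists_mem_gridIcoCube hh (hD x hx)).choose_spec⟩, fun ⟨_, hx, _⟩ => hx⟩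
  conv_lhs => rw [hcover]
  refine measureReal_biUnion_finset (fun k _ k' _ hkk' => ?_) (fun k _ => hDm.inter
    (measurableSet_gridIcoCube _ _)) (fun k _ => ?_)
  · exact (disjoint_gridIcoCube hh hkk').mono Set.inter_subset_right Set.inter_subset_right
  · exact ((measure_mono Set.inter_subset_right).trans_lt (volume_gridIcoCube_lt_top _ _)).ne

/-! ### Boundary cubes carry zeros of the product of the defining polynomials -/

/-- Two real numbers with different signs enclose `0`. [folklore] -/
theorem le_zero_le_of_sign_ne {u v : ℝ} (h : SignType.sign u ≠ SignType.sign v) :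
    (u ≤ 0 ∧ 0 ≤ v) ∨ (v ≤ 0 ∧ 0 ≤ u) := by
  rcases lt_trichotomy u 0 with hu | hu | hu <;> rcases lt_trichotomy v 0 with hv | hv | hv
  · exact absurd (by rw [sign_neg hu, sign_neg hv]) h
  · exact Or.inl ⟨hu.le, hv.ge⟩
  · exact Or.inl ⟨hu.le, hv.le⟩
  · exact Or.inr ⟨hv.le, hu.ge⟩
  · exact absurd (by rw [hu, hv]) h
  · exact Or.inl ⟨hu.le, hv.le⟩
  · exact Or.inr ⟨hv.le, hu.le⟩
  · exact Or.inr ⟨hv.le, hu.le⟩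
  · exact absurd (by rw [sign_pos hu, sign_pos hv]) h

/-- Evaluating the real form of a rational polynomial is `aeval`. [folklore] -/
theorem eval_map_algebraMap_eq_aeval {ι : Type*} (q : MvPolynomial ι ℚ) (x : ι → ℝ) :
    MvPolynomial.eval x (MvPolynomial.map (algebraMap ℚ ℝ) q) = MvPolynomial.aeval x q := by
  rw [MvPolynomial.aeval_def, MvPolynomial.eval₂_eq_eval_map]

/-- **Boundary cubes.**  Write a set `D` by simultaneous sign conditions on a finite family `Q` of
rational polynomials, and let `P` be the product of the real forms of the nonzero members of `Q`.
If a grid cube contains a point of `D` and a point of its complement, then `P` vanishes on the cube.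
[folklore] -/
theorem exists_eval_prod_eq_zero_of_mem_of_notMem {N : ℕ} (Q : Finset (MvPolynomial (Fin N) ℚ))
    (T : Set (Q → SignType)) {x₀ : Fin N → ℝ} {h : ℝ} {k : Fin N → ℕ} {y z : Fin N → ℝ}
    (hy : y ∈ gridCube x₀ h k) (hz : z ∈ gridCube x₀ h k)
    (hyD : (fun q : Q => SignType.sign (MvPolynomial.aeval y (q : MvPolynomial (Fin N) ℚ))) ∈ T)
    (hzD : (fun q : Q => SignType.sign (MvPolynomial.aeval z (q : MvPolynomial (Fin N) ℚ))) ∉ T) :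
    ∃ w ∈ gridCube x₀ h k, MvPolynomial.eval w
      (∏ q ∈ Q.filter (· ≠ 0), MvPolynomial.map (algebraMap ℚ ℝ) q) = 0 := by
  classical
  have hne : (fun q : Q => SignType.sign (MvPolynomial.aeval y (q : MvPolynomial (Fin N) ℚ))) ≠
      fun q : Q => SignType.sign (MvPolynomial.aeval z (q : MvPolynomial (Fin N) ℚ)) :=
    fun e => hzD (e ▸ hyD)
  obtain ⟨q, hq⟩ := Function.ne_iff.1 hne
  have hq0 : (q : MvPolynomial (Fin N) ℚ) ≠ 0 := fun e => hq (by simp [e])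
  set q' : MvPolynomial (Fin N) ℝ := MvPolynomial.map (algebraMap ℚ ℝ) (q : MvPolynomial (Fin N) ℚ)
    with hq'
  have hy' : MvPolynomial.eval y q' = MvPolynomial.aeval y (q : MvPolynomial (Fin N) ℚ) :=
    eval_map_algebraMap_eq_aeval _ _
  have hz' : MvPolynomial.eval z q' = MvPolynomial.aeval z (q : MvPolynomial (Fin N) ℚ) :=
    eval_map_algebraMap_eq_aeval _ _
  -- a zero `w` of `q'` on the cube
  obtain ⟨w, hw, hw0⟩ : ∃ w ∈ gridCube x₀ h k, MvPolynomial.eval w q' = 0 := by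
    rw [← hy', ← hz'] at hq
    rcases le_zero_le_of_sign_ne hq with ⟨h1, h2⟩ | ⟨h1, h2⟩
    · exact exists_eval_eq_zero_of_le_of_le q' hy hz h1 h2
    · exact exists_eval_eq_zero_of_le_of_le q' hz hy h1 h2
  refine ⟨w, hw, ?_⟩
  rw [map_prod]
  exact Finset.prod_eq_zero (Finset.mem_filter.2 ⟨q.2, hq0⟩) hw0

/-- The product of the real forms of the nonzero members of `Q` is a nonzero polynomial. [folklore] -/
theorem prod_map_ne_zero {N : ℕ} (Q : Finset (MvPolynomial (Fin N) ℚ)) :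
    (∏ q ∈ Q.filter (· ≠ 0), MvPolynomial.map (algebraMap ℚ ℝ) q) ≠ 0 := by
  classical
  rw [Finset.prod_ne_zero_iff]
  intro q hq
  rw [Finset.mem_filter] at hq
  exact fun e => hq.2 (MvPolynomial.map_injective _ (algebraMap ℚ ℝ).injective (by rw [e, map_zero]))

/-! ### The effective Riemann sum -/

/-- **Per-cube error.** For `0 ≤ a ≤ V` and `b ∈ {0, V}`: `|a - b| ≤ V`. [folklore] -/
theorem abs_sub_ite_le {a V : ℝ} (ha0 : 0 ≤ a) (haV : a ≤ V) (p : Prop) [Decidable p] :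
    |a - V * (if p then 1 else 0)| ≤ V := by
  split_ifs <;> rw [abs_le] <;> constructor <;> linarith

open Classical in
/-- **Effective Riemann sums** (Yoshinaga 2008, Lemma 29, vertex-rule form).  For a
`ℚ`-semialgebraic `D ⊆ [0, R)^{m+1}` there is `c` such that for all `n ≥ 1`
`|vol(D) - (R/n)^{m+1} · #{k ∈ {0,…,n-1}^{m+1} : (R kᵢ / n)ᵢ ∈ D}| ≤ c / n`.
[cite: Yoshinaga2008, Lemma 29] -/
theorem exists_abs_volume_sub_riemannSum_le {m : ℕ} {D : Set (Fin (m + 1) → ℝ)}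
    (hD : Literature.ModelTheory.ExponentialFields.IsSemialgebraic ℚ D) {R : ℕ} (hR : 0 < R)
    (hDR : ∀ x ∈ D, ∀ i, 0 ≤ x i ∧ x i < R) :
    ∃ c : ℕ, ∀ n : ℕ, 1 ≤ n →
      |volume.real D - ((R : ℝ) / n) ^ (m + 1) *
          (Finset.univ.filter fun k : Fin (m + 1) → Fin n =>
            (fun i => ((R : ℝ) / n) * ((k i : ℕ) : ℝ)) ∈ D).card| ≤ (c : ℝ) / n := by
  obtain ⟨Q, T, hDQ⟩ := hD.exists_eq_setOf_signVec_mem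
  set P : MvPolynomial (Fin (m + 1)) ℝ := ∏ q ∈ Q.filter (· ≠ 0), MvPolynomial.map (algebraMap ℚ ℝ) q
    with hP
  have hP0 : P ≠ 0 := prod_map_ne_zero Q
  obtain ⟨c₀, hc₀⟩ := exists_card_cubes_zeroSet_le m P.totalDegree
  refine ⟨c₀ * R ^ (m + 1), fun n hn => ?_⟩
  have hDm : MeasurableSet D :=
    Literature.ModelTheory.ExponentialFields.IsSemialgebraic.measurableSet_holds hD
  set h : ℝ := (R : ℝ) / n with hh_def
  have hn0 : (0 : ℝ) < n := by exact_mod_cast hn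
  have hh : 0 < h := div_pos (by exact_mod_cast hR) hn0
  have hhn : h * n = R := by rw [hh_def]; field_simp
  have hDR' : ∀ x ∈ D, ∀ i, 0 ≤ x i ∧ x i < h * n := by rw [hhn]; exact hDR
  -- bad cubes: the closed cube meets `Z(P)`
  set bad : (Fin (m + 1) → Fin n) → Prop := fun k =>
    ∃ w ∈ gridCube 0 h (fun i => (k i : ℕ)), MvPolynomial.eval w P = 0 with hbad
  have hcount : (Finset.univ.filter bad).card ≤ c₀ * n ^ m := hc₀ P hP0 le_rfl n 0 h hh
  -- per-cube estimate
  have hcube : ∀ k : Fin (m + 1) → Fin n,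
      |volume.real (D ∩ gridIcoCube h fun i => (k i : ℕ)) -
          h ^ (m + 1) * (if (fun i => h * ((k i : ℕ) : ℝ)) ∈ D then 1 else 0)| ≤
        if bad k then h ^ (m + 1) else 0 := by
    intro k
    have hvol : volume.real (gridIcoCube h fun i => (k i : ℕ)) = h ^ (m + 1) :=
      volume_real_gridIcoCube hh.le _
    have hle : volume.real (D ∩ gridIcoCube h fun i => (k i : ℕ)) ≤ h ^ (m + 1) := by
      rw [← hvol]
      exact measureReal_mono Set.inter_subset_right (volume_gridIcoCube_lt_top _ _).ne
    by_cases hb : bad k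
    · rw [if_pos hb]
      exact abs_sub_ite_le measureReal_nonneg hle _
    · rw [if_neg hb]
      -- no zero of `P` on the closed cube: the half-open cube is inside `D` or disjoint from `D`
      have hcorner : (fun i => h * ((k i : ℕ) : ℝ)) ∈ gridIcoCube h fun i => (k i : ℕ) :=
        corner_mem_gridIcoCube hh _
      have key : ∀ x ∈ gridIcoCube h (fun i => (k i : ℕ)),
          (x ∈ D ↔ (fun i => h * ((k i : ℕ) : ℝ)) ∈ D) := by
        intro x hx
        have hxc := gridIcoCube_subset_gridCube h _ hx
        have hcc := gridIcoCube_subset_gridCube h _ hcorner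
        constructor <;> intro h1 <;> by_contra h2
        · rw [hDQ] at h1 h2
          obtain ⟨w, hw, hw0⟩ := exists_eval_prod_eq_zero_of_mem_of_notMem Q T hxc hcc h1 h2
          exact hb ⟨w, hw, hw0⟩
        · rw [hDQ] at h1 h2
          obtain ⟨w, hw, hw0⟩ := exists_eval_prod_eq_zero_of_mem_of_notMem Q T hcc hxc h1 h2
          exact hb ⟨w, hw, hw0⟩
      by_cases hc : (fun i => h * ((k i : ℕ) : ℝ)) ∈ D
      · rw [if_pos hc, mul_one]
        have : D ∩ gridIcoCube h (fun i => (k i : ℕ)) = gridIcoCube h fun i => (k i : ℕ) :=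
          Set.inter_eq_right.2 fun x hx => (key x hx).2 hc
        rw [this, hvol, sub_self, abs_zero]
      · rw [if_neg hc, mul_zero, sub_zero]
        have : D ∩ gridIcoCube h (fun i => (k i : ℕ)) = ∅ :=
          Set.eq_empty_of_forall_notMem fun x hx => hc ((key x hx.2).1 hx.1)
        rw [this, measureReal_empty, abs_zero]
  -- summation
  have hsum : volume.real D =
      ∑ k : Fin (m + 1) → Fin n, volume.real (D ∩ gridIcoCube h fun i => (k i : ℕ)) :=
    volume_real_eq_sum_inter_gridIcoCube hh n hDm hDR'
  have hcard : ((Finset.univ.filter fun k : Fin (m + 1) → Fin n =>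
        (fun i => h * ((k i : ℕ) : ℝ)) ∈ D).card : ℝ) =
      ∑ k : Fin (m + 1) → Fin n, (if (fun i => h * ((k i : ℕ) : ℝ)) ∈ D then (1 : ℝ) else 0) := by
    rw [Finset.card_filter]
    push_cast
    rfl
  rw [hsum, hcard, Finset.mul_sum, ← Finset.sum_sub_distrib]
  calc |∑ k : Fin (m + 1) → Fin n, (volume.real (D ∩ gridIcoCube h fun i => (k i : ℕ)) -
          h ^ (m + 1) * (if (fun i => h * ((k i : ℕ) : ℝ)) ∈ D then (1 : ℝ) else 0))|
      ≤ ∑ k : Fin (m + 1) → Fin n, |volume.real (D ∩ gridIcoCube h fun i => (k i : ℕ)) -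
          h ^ (m + 1) * (if (fun i => h * ((k i : ℕ) : ℝ)) ∈ D then (1 : ℝ) else 0)| :=
        Finset.abs_sum_le_sum_abs _ _
    _ ≤ ∑ k : Fin (m + 1) → Fin n, (if bad k then h ^ (m + 1) else 0) :=
        Finset.sum_le_sum fun k _ => hcube k
    _ = h ^ (m + 1) * (Finset.univ.filter bad).card := by
        rw [← Finset.sum_filter, Finset.sum_const, nsmul_eq_mul, mul_comm]
    _ ≤ h ^ (m + 1) * (c₀ * n ^ m : ℕ) := by
        exact mul_le_mul_of_nonneg_left (by exact_mod_cast hcount) (pow_nonneg hh.le _)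
    _ = ((c₀ * R ^ (m + 1) : ℕ) : ℝ) / n := by
        have hn' : (n : ℝ) ≠ 0 := hn0.ne'
        rw [hh_def, div_pow]
        push_cast
        field_simp
        ring

end Literature.NumberTheory.Transcendental
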